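import Mathlib

/-!
# T-S5.4h «Gaussian second moments» — the moment companion of T-S5.4a `gaussianDeterminantFormula`

Step (1b) of the XL comparison stubs S5 (LINE-19 ⟨stmt-QuantumFields-24004⟩/⟨24335⟩, `stub_landauSecondOrder`) and U5 (LINE-20
⟨24336⟩, `stub_landauThirdOrder`) evaluates the orbit average `N_h(U)` by Laplace's method around the Gaussian
`v ↦ exp(−β ‖M v‖²)` on `Fin n → ℝ` (`M = fpOperator H U`, planner ym-idea-2 g17's `STUB-PLAN-S5U5-STEP1b.md` §3).  Every
first-order correction in that budget (the Haar flatness 4d, the cubic remainder 4e) is charged against ONE number: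

  `E_G[‖B A‖²] = (2β)⁻¹ · ‖B M⁻¹‖_F² = (2β)⁻¹ · tr(B (MᵀM)⁻¹ Bᵀ)`   (with `B = 1`: `E Σ_x |A_x|² = (2β)⁻¹ tr (MᵀM)⁻¹`).

This file proves exactly that, in the letters of ✓`gaussianDeterminantFormula` (Lebesgue measure on the pi type, `M.mulVec v ⬝ᵥ M.mulVec v`):

* `integral_sq_mul_exp_neg_mul_sq`, `integral_mul_exp_neg_mul_sq_eq_zero` — the one-dimensional moments
  `∫ s² e^{−bs²} ds = √(π/b)/(2b)`, `∫ s e^{−bs²} ds = 0`;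
* `integral_coord_mul_coord_mul_exp` — the pair moments of the isotropic Gaussian on `Fin n → ℝ`:
  `∫ w_j w_k e^{−β w⬝w} dw = δ_{jk} (2β)⁻¹ √(π/β)ⁿ` (Fubini in the form `integral_fintype_prod_volume_eq_prod`);
* `integral_dotProduct_mulVec_mul_exp` — `∫ (w ⬝ᵥ Q w) e^{−β w⬝w} dw = (2β)⁻¹ √(π/β)ⁿ · tr Q`;
* `integral_mulVec_dotProduct_mulVec_mul_exp` — `∫ ‖C w‖² e^{−β w⬝w} dw = (2β)⁻¹ √(π/β)ⁿ · Σ_{ij} C_{ij}²`;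
* **`gaussianSecondMoment`** — the change of variables `w = M v` on top:
  `∫ ‖B v‖² exp(−β ‖M v‖²) dv = √(π/β)ⁿ/|det M| · (2β)⁻¹ · Σ_{ij} ((B M⁻¹)_{ij})²`.

Mathlib only; no definitions.  HONEST LABEL: an elementary analytic brick of step (1b); T-S5.4 itself (the Laplace asymptotics of
`N_h`), S5, U5, ⟨24004⟩ ⟨24335⟩ ⟨24336⟩ remain OPEN; no summit is proved; the Yang–Mills mass gap is NOT proved by this file.
Seat ym-line-sfw-p2 g77 (LEAD, cell ym-idea-1).
-/

set_option autoImplicit false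

noncomputable section

open MeasureTheory Matrix Finset

namespace Summit.QuantumFields.YangMills.Theorems.AllWindowsColdBoxBoxHighLine

/-! ## One-dimensional moments -/

/-- `∫_ℝ s² e^{−b s²} ds = √(π/b) / (2b)` for `b > 0` (from `Γ(3/2) = √π/2`). -/
theorem integral_sq_mul_exp_neg_mul_sq {b : ℝ} (hb : 0 < b) :
    ∫ s : ℝ, s ^ 2 * Real.exp (-(b * s ^ 2)) = Real.sqrt (Real.pi / b) / (2 * b) := by
  have h := integral_comp_abs (f := fun u : ℝ => u ^ 2 * Real.exp (-(b * u ^ 2)))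
  simp only [sq_abs] at h
  rw [h]
  have h2 := integral_rpow_mul_exp_neg_mul_rpow (p := 2) (q := 2) two_pos (by norm_num) hb
  have h2' : ∫ x in Set.Ioi (0 : ℝ), x ^ 2 * Real.exp (-(b * x ^ 2)) =
      b ^ (-(2 + 1 : ℝ) / 2) * (1 / 2) * Real.Gamma ((2 + 1) / 2) := by
    rw [← h2]
    refine setIntegral_congr_fun measurableSet_Ioi fun x _ => ?_
    rw [show x ^ (2 : ℝ) = x ^ 2 by norm_cast, neg_mul]
  rw [h2']
  have hG : Real.Gamma ((2 + 1 : ℝ) / 2) = Real.sqrt Real.pi / 2 := by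
    rw [show ((2 : ℝ) + 1) / 2 = 1 / 2 + 1 by norm_num, Real.Gamma_add_one (by norm_num),
      Real.Gamma_one_half_eq]
    ring
  have hb32 : b ^ (-(2 + 1 : ℝ) / 2) = (b * Real.sqrt b)⁻¹ := by
    rw [show (-(2 + 1 : ℝ)) / 2 = -(1 + 1 / 2) by norm_num, Real.rpow_neg hb.le, Real.rpow_add hb,
      Real.rpow_one, Real.sqrt_eq_rpow]
  rw [hG, hb32, Real.sqrt_div Real.pi_pos.le]
  have hsb : 0 < Real.sqrt b := Real.sqrt_pos.mpr hb
  field_simp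

/-- `∫_ℝ s e^{−b s²} ds = 0` (odd integrand; Lebesgue measure is invariant under `s ↦ −s`). -/
theorem integral_mul_exp_neg_mul_sq_eq_zero (b : ℝ) : ∫ s : ℝ, s * Real.exp (-(b * s ^ 2)) = 0 := by
  have h := integral_neg_eq_self (fun s : ℝ => s * Real.exp (-(b * s ^ 2))) volume
  simp only [neg_mul, neg_sq, integral_neg] at h
  linarith

/-- `s ^ m · e^{−b s²}` is integrable on `ℝ` for every natural `m` and `b > 0`. -/
theorem integrable_pow_mul_exp_neg_mul_sq {b : ℝ} (hb : 0 < b) (m : ℕ) :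
    Integrable fun s : ℝ => s ^ m * Real.exp (-(b * s ^ 2)) := by
  have h := integrable_rpow_mul_exp_neg_mul_sq hb (s := (m : ℝ))
    (by have := Nat.cast_nonneg (α := ℝ) m; linarith)
  simpa [neg_mul, Real.rpow_natCast] using h

/-! ## Pair moments of the isotropic Gaussian on `Fin n → ℝ` -/

variable {n : ℕ}

/-- `∏ i, (w i)^{[i = j]} = w j`. -/
theorem prod_pow_ite_eq (j : Fin n) (w : Fin n → ℝ) :
    ∏ i, (w i) ^ (if i = j then 1 else 0) = w j := by
  have h : ∀ i, (w i) ^ (if i = j then 1 else 0) = if i = j then w i else 1 := fun i => by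
    split_ifs <;> simp
  simp_rw [h]
  simp [Finset.prod_ite_eq']

/-- `w_j w_k e^{−β w⬝w}` in product form over the coordinates (exponent `[i=j] + [i=k]` at coordinate `i`). -/
theorem coord_mul_coord_mul_exp_eq_prod (β : ℝ) (j k : Fin n) (w : Fin n → ℝ) :
    w j * w k * Real.exp (-(β * (w ⬝ᵥ w))) =
      ∏ i, ((w i) ^ ((if i = j then 1 else 0) + (if i = k then 1 else 0)) * Real.exp (-(β * (w i) ^ 2))) := by
  rw [Finset.prod_mul_distrib]
  simp only [pow_add, Finset.prod_mul_distrib, prod_pow_ite_eq]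
  congr 1
  rw [← Real.exp_sum]
  congr 1
  simp only [dotProduct, Finset.mul_sum, ← Finset.sum_neg_distrib, pow_two]

/-- `w ↦ w_j w_k e^{−β w⬝w}` is integrable on `ℝⁿ` (`β > 0`). -/
theorem integrable_coord_mul_coord_mul_exp {β : ℝ} (hβ : 0 < β) (j k : Fin n) :
    Integrable fun w : Fin n → ℝ => w j * w k * Real.exp (-(β * (w ⬝ᵥ w))) := by
  simp_rw [coord_mul_coord_mul_exp_eq_prod β j k]
  exact Integrable.fintype_prod
    (f := fun i (s : ℝ) => s ^ ((if i = j then 1 else 0) + (if i = k then 1 else 0)) * Real.exp (-(β * s ^ 2)))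
    fun i => integrable_pow_mul_exp_neg_mul_sq hβ _

/-- **Pair moments**: `∫ w_j w_k e^{−β w⬝w} dw = δ_{jk} · (2β)⁻¹ · √(π/β)ⁿ`. -/
theorem integral_coord_mul_coord_mul_exp {β : ℝ} (hβ : 0 < β) (j k : Fin n) :
    ∫ w : Fin n → ℝ, w j * w k * Real.exp (-(β * (w ⬝ᵥ w))) =
      if j = k then (2 * β)⁻¹ * Real.sqrt (Real.pi / β) ^ n else 0 := by
  simp_rw [coord_mul_coord_mul_exp_eq_prod β j k]
  rw [integral_fintype_prod_volume_eq_prod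
    (fun i (s : ℝ) => s ^ ((if i = j then 1 else 0) + (if i = k then 1 else 0)) * Real.exp (-(β * s ^ 2)))]
  by_cases hjk : j = k
  · subst hjk
    simp only [if_true]
    rw [← Finset.mul_prod_erase Finset.univ _ (Finset.mem_univ j)]
    have hj : (∫ s : ℝ, s ^ ((if j = j then 1 else 0) + (if j = j then 1 else 0)) * Real.exp (-(β * s ^ 2))) =
        Real.sqrt (Real.pi / β) / (2 * β) := by
      simp only [if_true, Nat.reduceAdd]
      exact integral_sq_mul_exp_neg_mul_sq hβ
    have hi : ∀ i ∈ Finset.univ.erase j,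
        (∫ s : ℝ, s ^ ((if i = j then 1 else 0) + (if i = j then 1 else 0)) * Real.exp (-(β * s ^ 2))) =
          Real.sqrt (Real.pi / β) := fun i hi => by
      simp only [Finset.ne_of_mem_erase hi, if_false, Nat.add_zero, pow_zero, one_mul]
      simpa [neg_mul] using integral_gaussian β
    rw [hj, Finset.prod_congr rfl hi, Finset.prod_const, Finset.card_erase_of_mem (Finset.mem_univ j),
      Finset.card_univ, Fintype.card_fin]
    have hn : 1 ≤ n := Nat.succ_le_of_lt j.pos
    conv_rhs => rw [← Nat.sub_add_cancel hn, pow_succ]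
    field_simp
  · simp only [hjk, if_false]
    apply Finset.prod_eq_zero (Finset.mem_univ j)
    have hkj : ¬ (j = k) := hjk
    simp only [if_true, hkj, if_false, Nat.add_zero, pow_one]
    exact integral_mul_exp_neg_mul_sq_eq_zero β

/-! ## Quadratic forms against the isotropic Gaussian -/

/-- `∫ (w ⬝ᵥ Q w) e^{−β w⬝w} dw = (2β)⁻¹ √(π/β)ⁿ · tr Q`. -/
theorem integral_dotProduct_mulVec_mul_exp {β : ℝ} (hβ : 0 < β) (Q : Matrix (Fin n) (Fin n) ℝ) :
    ∫ w : Fin n → ℝ, (w ⬝ᵥ Q.mulVec w) * Real.exp (-(β * (w ⬝ᵥ w))) =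
      (2 * β)⁻¹ * Real.sqrt (Real.pi / β) ^ n * Q.trace := by
  have hexp : ∀ w : Fin n → ℝ, (w ⬝ᵥ Q.mulVec w) * Real.exp (-(β * (w ⬝ᵥ w))) =
      ∑ j, ∑ k, Q j k * (w j * w k * Real.exp (-(β * (w ⬝ᵥ w)))) := by
    intro w
    simp only [dotProduct, Matrix.mulVec, Finset.sum_mul, Finset.mul_sum]
    refine Finset.sum_congr rfl fun j _ => Finset.sum_congr rfl fun k _ => ?_
    ring
  simp_rw [hexp]
  rw [integral_finsetSum _ fun j _ => integrable_finsetSum _ fun k _ =>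
    (integrable_coord_mul_coord_mul_exp hβ j k).const_mul _]
  simp_rw [integral_finsetSum _ fun k _ => (integrable_coord_mul_coord_mul_exp hβ _ k).const_mul _,
    integral_const_mul, integral_coord_mul_coord_mul_exp hβ, mul_ite, mul_zero, Finset.sum_ite_eq,
    Finset.mem_univ, if_true, Matrix.trace, Matrix.diag]
  rw [Finset.mul_sum]
  refine Finset.sum_congr rfl fun j _ => ?_
  ring

/-- `‖C w‖² = w ⬝ᵥ (CᵀC) w`. -/
theorem mulVec_dotProduct_mulVec_eq (C : Matrix (Fin n) (Fin n) ℝ) (w : Fin n → ℝ) :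
    C.mulVec w ⬝ᵥ C.mulVec w = w ⬝ᵥ (Cᵀ * C).mulVec w := by
  rw [← Matrix.mulVec_mulVec, Matrix.dotProduct_mulVec w Cᵀ (C.mulVec w), Matrix.vecMul_transpose]

/-- `tr(CᵀC) = Σ_{ij} C_{ij}²`. -/
theorem trace_transpose_mul_self (C : Matrix (Fin n) (Fin n) ℝ) :
    (Cᵀ * C).trace = ∑ i, ∑ j, (C i j) ^ 2 := by
  simp only [Matrix.trace, Matrix.diag, Matrix.mul_apply, Matrix.transpose_apply, pow_two]
  rw [Finset.sum_comm]

/-- `∫ ‖C w‖² e^{−β w⬝w} dw = (2β)⁻¹ √(π/β)ⁿ · Σ_{ij} C_{ij}²` (the Frobenius norm of `C`). -/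
theorem integral_mulVec_dotProduct_mulVec_mul_exp {β : ℝ} (hβ : 0 < β) (C : Matrix (Fin n) (Fin n) ℝ) :
    ∫ w : Fin n → ℝ, (C.mulVec w ⬝ᵥ C.mulVec w) * Real.exp (-(β * (w ⬝ᵥ w))) =
      (2 * β)⁻¹ * Real.sqrt (Real.pi / β) ^ n * ∑ i, ∑ j, (C i j) ^ 2 := by
  simp_rw [mulVec_dotProduct_mulVec_eq C]
  rw [integral_dotProduct_mulVec_mul_exp hβ, trace_transpose_mul_self]

/-- The integrand `‖C w‖² e^{−β w⬝w}` is integrable (`β > 0`). -/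
theorem integrable_mulVec_dotProduct_mulVec_mul_exp {β : ℝ} (hβ : 0 < β) (C : Matrix (Fin n) (Fin n) ℝ) :
    Integrable fun w : Fin n → ℝ => (C.mulVec w ⬝ᵥ C.mulVec w) * Real.exp (-(β * (w ⬝ᵥ w))) := by
  have hexp : ∀ w : Fin n → ℝ, (C.mulVec w ⬝ᵥ C.mulVec w) * Real.exp (-(β * (w ⬝ᵥ w))) =
      ∑ j, ∑ k, (Cᵀ * C) j k * (w j * w k * Real.exp (-(β * (w ⬝ᵥ w)))) := by
    intro w
    rw [mulVec_dotProduct_mulVec_eq C]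
    simp only [dotProduct, Matrix.mulVec, Finset.sum_mul, Finset.mul_sum]
    refine Finset.sum_congr rfl fun j _ => Finset.sum_congr rfl fun k _ => ?_
    ring
  simp_rw [hexp]
  exact integrable_finsetSum _ fun j _ => integrable_finsetSum _ fun k _ =>
    (integrable_coord_mul_coord_mul_exp hβ j k).const_mul _

/-! ## The anisotropic statement: change of variables `w = M v` -/

/-- **T-S5.4h (Gaussian second moment).**  For an invertible real `n × n` matrix `M`, any `B` and `β > 0`:
`∫_{ℝⁿ} ‖B v‖² exp(−β ‖M v‖²) dv = √(π/β)ⁿ / |det M| · (2β)⁻¹ · Σ_{ij} ((B M⁻¹)_{ij})²`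
— i.e. `E_G[‖B v‖²] = (2β)⁻¹ ‖B M⁻¹‖_F² = (2β)⁻¹ tr(B (MᵀM)⁻¹ Bᵀ)` under the normalised Gaussian of ✓`gaussianDeterminantFormula`. -/
theorem gaussianSecondMoment (n : ℕ) (M B : Matrix (Fin n) (Fin n) ℝ) (β : ℝ) (hM : M.det ≠ 0) (hβ : 0 < β) :
    ∫ v : Fin n → ℝ, (B.mulVec v ⬝ᵥ B.mulVec v) * Real.exp (-(β * (M.mulVec v ⬝ᵥ M.mulVec v))) =
      Real.sqrt (Real.pi / β) ^ n / |M.det| * ((2 * β)⁻¹ * ∑ i, ∑ j, ((B * M⁻¹) i j) ^ 2) := by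
  have hMu : IsUnit M.det := isUnit_iff_ne_zero.mpr hM
  set C : Matrix (Fin n) (Fin n) ℝ := B * M⁻¹ with hC
  set g : (Fin n → ℝ) → ℝ := fun w => (C.mulVec w ⬝ᵥ C.mulVec w) * Real.exp (-(β * (w ⬝ᵥ w))) with hg
  have hCM : ∀ v : Fin n → ℝ, C.mulVec (M.mulVec v) = B.mulVec v := fun v => by
    rw [hC, Matrix.mulVec_mulVec, Matrix.mul_assoc, Matrix.nonsing_inv_mul _ hMu, Matrix.mul_one]
  have hgc : Continuous g := by
    have h1 : Continuous fun w : Fin n → ℝ => C.mulVec w :=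
      (Matrix.toLin' C).continuous_of_finiteDimensional.congr fun w => Matrix.toLin'_apply C w
    have h2 : Continuous fun w : Fin n → ℝ => C.mulVec w ⬝ᵥ C.mulVec w := by
      simp only [dotProduct]
      fun_prop
    have h3 : Continuous fun w : Fin n → ℝ => Real.exp (-(β * (w ⬝ᵥ w))) := by
      simp only [dotProduct]
      fun_prop
    exact h2.mul h3
  have h1 : (fun v : Fin n → ℝ => (B.mulVec v ⬝ᵥ B.mulVec v) * Real.exp (-(β * (M.mulVec v ⬝ᵥ M.mulVec v)))) =
      fun v => g (Matrix.toLin' M v) := by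
    funext v; simp only [hg, Matrix.toLin'_apply, hCM]
  rw [h1, ← integral_map (Matrix.toLin' M).continuous_of_finiteDimensional.aemeasurable hgc.aestronglyMeasurable,
    Real.map_matrix_volume_pi_eq_smul_volume_pi hM, integral_smul_measure, hg,
    integral_mulVec_dotProduct_mulVec_mul_exp hβ C, ENNReal.toReal_ofReal (abs_nonneg _), abs_inv, smul_eq_mul]
  ring

end Summit.QuantumFields.YangMills.Theorems.AllWindowsColdBoxBoxHighLine

end
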